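import Summits.RiemannHypothesis.RiemannHypothesis.Theorems.HandoffDodgerSmallProfile
import HarnessLib

/-!
# HANDOFF — THIRD SLAB (2): the profile-control constants at `y = 38`, `N₁ = 46` (rh-explicit, D-0040 WEIL column prover seat handoff-prove-2 gen13, ATTEMPT-23)

RH-FREE. HONEST FRAMING: nothing here bears on the truth of RH; this is part (2) of the discharge of the hypotheses of
`HandoffDodgerExplicit.dodger_witness_explicit` on the third slab `12500 ≤ q < 25000` at the CONSTANT schedule `y = 38`,
`N₁ = 46`: `N₁ + 1 ≤ pL/(2W)`, `ρ₁ < 1` (indeed `ρ₁ ≤ 0.76`), `ρ₂ ≤ e^{−2}`, and the profile-control constant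
**`κ ≥ 11/50`** (`η ≤ 0.7586` from `2(1/pL + k(T+½)/pL²)·W·N₁² ≤ 0.5645`, `3τ₁ ≤ 0.0003`, `τ₂ ≤ 10⁻⁴`), from the numeric
sizes of part (1) (`213000 ≤ T′`, `T′² ≤ W ≤ T′² + 1/4`, `k′ ≤ 0.3184·b·T′`, `T′³/28.36 ≤ pL`, `b ≤ 5.07`).

References: this track (ATTEMPT-16 §3 (D1), ATTEMPT-19 §8, ATTEMPT-21 §3, ATTEMPT-23 §7).
-/

set_option linter.dupNamespace false

noncomputable section

open Real

namespace Summit.RiemannHypothesis.RiemannHypothesis.Theorems.Handoff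

/-! ## The pieces -/

/-- `ν = k(T+½)/pL ≤ 2.2·10⁻⁴` on the third slab. [this track, ATTEMPT-23 §7] -/
theorem nu_le_slabThree {T k pL : ℝ} (hT : 213000 ≤ T) (hk : k ≤ 1.615 * T) (hpL : T ^ 3 / 28.36 ≤ pL) :
    k * (T + 1 / 2) / pL ≤ 22 / 100000 := by
  have hT0 : 0 < T := by linarith
  have hpL0 : 0 < pL := lt_of_lt_of_le (by positivity) hpL
  rw [div_le_iff₀ hpL0]
  have h1 : k * (T + 1 / 2) ≤ 1.615 * T * (1.000003 * T) :=
    mul_le_mul hk (by linarith only [hT]) (by linarith only [hT0]) (by positivity)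
  have h4 : T ^ 3 ≤ 28.36 * pL := by rw [div_le_iff₀ (by norm_num)] at hpL; linarith only [hpL]
  nlinarith only [h1, h4, hT, sq_nonneg T, hT0]

/-- `47 ≤ pL/(2W)` on the third slab. [this track, ATTEMPT-23 §7] -/
theorem N_le_slabThree {T pL W : ℝ} (hT : 213000 ≤ T) (hW0 : 0 < W) (hW3 : W ≤ T ^ 2 + 1 / 4) (hpL : T ^ 3 / 28.36 ≤ pL) :
    (47 : ℝ) ≤ pL / (2 * W) := by
  have hT0 : 0 < T := by linarith
  rw [le_div_iff₀ (by positivity)]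
  have h4 : T ^ 3 ≤ 28.36 * pL := by rw [div_le_iff₀ (by norm_num)] at hpL; linarith only [hpL]
  nlinarith only [h4, hW3, hT, sq_nonneg T, hT0]

/-- `ρ₁ ≤ 0.76` at `y = 38`, `N₁ = 46`. [this track, ATTEMPT-23 §7] -/
theorem rho1_le_slabThree {ν lamU ρ1 E y : ℝ} {N₁ : ℕ} (hν0 : 0 ≤ ν) (hν : ν ≤ 22 / 100000) (hlamU : lamU = 1 + ν)
    (hE : E = Real.exp (3 + lamU)) (hy : y = 38) (hN₁ : N₁ = 46)
    (hρ1 : ρ1 = E * (4 * y ^ 2) / (4 * ((N₁ : ℝ) + 1) ^ 3)) : ρ1 ≤ 0.76 := by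
  have hexp : E ≤ 54.613 := by
    have e1 : 3 + lamU = 4 + ν := by rw [hlamU]; ring
    rw [hE, e1, Real.exp_add]
    have h1 := exp_numerics.2.2.1
    have h2 : Real.exp ν ≤ 1 + ν + ν ^ 2 := by
      have := Real.abs_exp_sub_one_sub_id_le (x := ν) (by rw [abs_of_nonneg hν0]; linarith only [hν])
      have := (abs_le.1 this).2
      linarith only [this]
    have h3 : 1 + ν + ν ^ 2 ≤ 1.0002201 := by nlinarith only [hν, hν0]
    calc Real.exp 4 * Real.exp ν ≤ 54.6 * 1.0002201 :=
          mul_le_mul h1.le (h2.trans h3) (Real.exp_pos _).le (by norm_num)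
      _ ≤ 54.613 := by norm_num
  rw [hρ1, hy, hN₁, div_le_iff₀ (by positivity)]
  push_cast
  nlinarith only [hexp]

/-- `τ₁ ≤ 10⁻⁴` from `ρ₁ ≤ 0.76` and `N₁ = 46`. [this track, ATTEMPT-23 §7] -/
theorem tau1_le_slabThree {ρ1 τ1 : ℝ} {N₁ : ℕ} (hρ1ge : 0 ≤ ρ1) (hρ1le : ρ1 ≤ 0.76) (hN₁ : N₁ = 46)
    (hτ1 : τ1 = ρ1 ^ (N₁ + 1) / (1 - ρ1)) : τ1 ≤ 1 / 10000 := by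
  rw [hτ1, hN₁, div_le_iff₀ (by linarith only [hρ1le])]
  have h2 : ρ1 ^ (46 + 1) ≤ (0.76 : ℝ) ^ (46 + 1) := pow_le_pow_left₀ hρ1ge hρ1le _
  have h3 : (0.76 : ℝ) ^ (46 + 1) ≤ 1 / 100000 := by norm_num
  nlinarith only [h2, h3, hρ1le]

/-- `ρ₂ ≤ 10⁻⁶` at `y = 38` on the third slab. [this track, ATTEMPT-23 §7] -/
theorem rho2_le_slabThree {T pL W ρ2U y : ℝ} (hT : 213000 ≤ T) (hW0 : 0 < W) (hW3 : W ≤ T ^ 2 + 1 / 4)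
    (hpL : T ^ 3 / 28.36 ≤ pL) (hy : y = 38)
    (hρ2U : ρ2U = 8 * Real.exp 2 * W ^ 3 * y ^ 2 / pL ^ 3) : ρ2U ≤ 1 / 10 ^ 6 := by
  have hT0 : 0 < T := by linarith
  have hpL0 : 0 < pL := lt_of_lt_of_le (by positivity) hpL
  rw [hρ2U, hy, div_le_iff₀ (by positivity)]
  have hW2 : W ≤ 1.00001 * T ^ 2 := by nlinarith only [hW3, hT]
  have hW3' : W ^ 3 ≤ (1.00001 * T ^ 2) ^ 3 := pow_le_pow_left₀ hW0.le hW2 3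
  have hp3 : (T ^ 3 / 28.36) ^ 3 ≤ pL ^ 3 := pow_le_pow_left₀ (by positivity) hpL 3
  have e2 := exp_numerics.1
  have h1 : 8 * Real.exp 2 * W ^ 3 * (38 : ℝ) ^ 2 ≤ 8 * 7.39 * (1.00001 * T ^ 2) ^ 3 * 38 ^ 2 := by
    have := mul_le_mul e2.le hW3' (by positivity) (by norm_num)
    nlinarith only [this]
  have h2 : 8 * 7.39 * (1.00001 * T ^ 2) ^ 3 * (38 : ℝ) ^ 2 ≤ 1 / 10 ^ 6 * (T ^ 3 / 28.36) ^ 3 := by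
    have e1 : (T ^ 3 / 28.36) ^ 3 = T ^ 6 * T ^ 3 / 28.36 ^ 3 := by ring
    have e3 : 8 * 7.39 * (1.00001 * T ^ 2) ^ 3 * (38 : ℝ) ^ 2 = 8 * 7.39 * 1.00001 ^ 3 * 38 ^ 2 * T ^ 6 := by ring
    rw [e1, e3]
    have hT3 : (213000 : ℝ) ^ 3 ≤ T ^ 3 := pow_le_pow_left₀ (by norm_num) hT 3
    have hT6 : (0 : ℝ) ≤ T ^ 6 := by positivity
    have key : 8 * 7.39 * 1.00001 ^ 3 * 38 ^ 2 * ((28.36 : ℝ) ^ 3 * 10 ^ 6) ≤ T ^ 3 := le_trans (by norm_num) hT3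
    have hk := mul_le_mul_of_nonneg_left key hT6
    rw [show 1 / 10 ^ 6 * (T ^ 6 * T ^ 3 / 28.36 ^ 3) = T ^ 6 * T ^ 3 / ((28.36 : ℝ) ^ 3 * 10 ^ 6) by ring]
    rw [le_div_iff₀ (by norm_num)]
    nlinarith only [hk]
  nlinarith only [h1, h2, hp3]

/-- `τ₂ ≤ 10⁻⁴` on the third slab. [this track, ATTEMPT-23 §7 (same mechanism as gen10's `tau2_le`)] -/
theorem tau2_le_slabThree {T k pL W ρ2U τ2U : ℝ} (hT : 213000 ≤ T) (hk : k ≤ 1.615 * T)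
    (hW1 : T ^ 2 ≤ W) (hW3 : W ≤ T ^ 2 + 1 / 4) (hpL : T ^ 3 / 28.36 ≤ pL)
    (hρ2ge : 0 < ρ2U) (hρ2le : ρ2U ≤ 1 / 10 ^ 6)
    (hτ2U : τ2U = Real.exp (pL / W * (1 + 1 / 2 * Real.log ρ2U) + k * (T + 1 / 2) / (2 * W)) / (1 - ρ2U)) :
    τ2U ≤ 1 / 10000 := by
  have hT0 : 0 < T := by linarith
  have hpL0 : 0 < pL := lt_of_lt_of_le (by positivity) hpL
  have hW0 : 0 < W := lt_of_lt_of_le (by positivity) hW1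
  rw [hτ2U, div_le_iff₀ (by linarith only [hρ2le])]
  have hlog : Real.log ρ2U ≤ -4 := by
    rw [Real.log_le_iff_le_exp hρ2ge]
    refine hρ2le.trans ?_
    rw [Real.exp_neg, le_inv_comm₀ (by norm_num) (Real.exp_pos _)]
    have := exp_numerics.2.2.1
    norm_num; linarith only [this]
  have hpW : T / 28.37 ≤ pL / W := by
    rw [div_le_div_iff₀ (by norm_num) hW0]
    have h4 : T ^ 3 ≤ 28.36 * pL := by rw [div_le_iff₀ (by norm_num)] at hpL; linarith only [hpL]
    nlinarith only [hW3, h4, hpL0, hT, hT0]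
  have hA : pL / W * (1 + 1 / 2 * Real.log ρ2U) ≤ -(T / 28.37) := by
    have h1 : 1 + 1 / 2 * Real.log ρ2U ≤ -1 := by linarith only [hlog]
    have h2 : 0 < pL / W := by positivity
    nlinarith only [h1, h2, hpW]
  have hB : k * (T + 1 / 2) / (2 * W) ≤ 1 := by
    rw [div_le_iff₀ (by positivity)]
    have h1 : k * (T + 1 / 2) ≤ 1.615 * T * (1.000003 * T) :=
      mul_le_mul hk (by linarith only [hT]) (by linarith only [hT0]) (by positivity)
    nlinarith only [h1, hW1]
  have hX : pL / W * (1 + 1 / 2 * Real.log ρ2U) + k * (T + 1 / 2) / (2 * W) ≤ -10 := by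
    have h2 : 11 ≤ T / 28.37 := by rw [le_div_iff₀ (by norm_num)]; linarith only [hT]
    linarith only [hA, hB, h2]
  have hE : Real.exp (pL / W * (1 + 1 / 2 * Real.log ρ2U) + k * (T + 1 / 2) / (2 * W)) ≤ 1 / 20000 := by
    refine (Real.exp_le_exp.2 hX).trans ?_
    rw [Real.exp_neg, inv_le_comm₀ (Real.exp_pos _) (by norm_num)]
    have h10 : Real.exp 10 = Real.exp 4 * Real.exp 4 * Real.exp 2 := by rw [← Real.exp_add, ← Real.exp_add]; norm_num
    rw [h10]; norm_num; nlinarith only [exp_numerics.2.2.2, exp_numerics.2.1, Real.exp_pos 2, Real.exp_pos 4]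
  nlinarith only [hE, hρ2le, Real.exp_pos (pL / W * (1 + 1 / 2 * Real.log ρ2U) + k * (T + 1 / 2) / (2 * W))]

/-- **`η ≤ 0.7586`** at `N₁ = 46` on the third slab: the exponent `2(1/pL + k(T+½)/pL²)·W·N₁² ≤ 0.5645` since `pL ≥ T³/28.36`,
`W ≤ T² + 1/4`, `T ≥ 213000`; then `e^{0.5645} ≤ 1.7586` (Taylor with remainder). [this track, ATTEMPT-23 §7] -/
theorem eta_le_slabThree {T k pL W ηU : ℝ} {N₁ : ℕ} (hT : 213000 ≤ T) (hk0 : 0 ≤ k) (hW0 : 0 < W) (hW3 : W ≤ T ^ 2 + 1 / 4)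
    (hpL : T ^ 3 / 28.36 ≤ pL) (hν : k * (T + 1 / 2) / pL ≤ 22 / 100000) (hN₁ : N₁ = 46)
    (hηU : ηU = Real.exp (2 * (1 / pL + k * (T + 1 / 2) / pL ^ 2) * W * (N₁ : ℝ) ^ 2) - 1) : ηU ≤ 0.7586 := by
  have hT0 : 0 < T := by linarith
  have hpL0 : 0 < pL := lt_of_lt_of_le (by positivity) hpL
  rw [hηU, hN₁]
  push_cast
  set u := 2 * (1 / pL + k * (T + 1 / 2) / pL ^ 2) * W * (46 : ℝ) ^ 2 with hu
  have hu0 : 0 ≤ u := by positivity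
  have hinner : 1 / pL + k * (T + 1 / 2) / pL ^ 2 ≤ 100022 / 100000 / pL := by
    have e : 1 / pL + k * (T + 1 / 2) / pL ^ 2 = (1 + k * (T + 1 / 2) / pL) / pL := by
      field_simp
    rw [e]; exact div_le_div_of_nonneg_right (by linarith only [hν]) hpL0.le
  have hu1 : u ≤ 0.5645 := by
    have h1 : u ≤ 2 * (100022 / 100000 / pL) * (T ^ 2 + 1 / 4) * (46 : ℝ) ^ 2 := by
      rw [hu]
      have a1 : 2 * (1 / pL + k * (T + 1 / 2) / pL ^ 2) * W ≤ 2 * (100022 / 100000 / pL) * (T ^ 2 + 1 / 4) :=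
        mul_le_mul (by linarith only [hinner]) hW3 hW0.le (by positivity)
      exact mul_le_mul_of_nonneg_right a1 (by positivity)
    have h2 : 2 * (100022 / 100000 / pL) * (T ^ 2 + 1 / 4) * (46 : ℝ) ^ 2 ≤ 0.5645 := by
      have e : 2 * (100022 / 100000 / pL) * (T ^ 2 + 1 / 4) * (46 : ℝ) ^ 2 =
          2 * (100022 / 100000) * 46 ^ 2 * (T ^ 2 + 1 / 4) / pL := by
        field_simp
      rw [e, div_le_iff₀ hpL0]
      have h4 : T ^ 3 ≤ 28.36 * pL := by rw [div_le_iff₀ (by norm_num)] at hpL; linarith only [hpL]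
      have h5 : 213000 * T ^ 2 ≤ T ^ 3 := by nlinarith only [hT, sq_nonneg T]
      have h6 : (213000 : ℝ) ^ 2 ≤ T ^ 2 := pow_le_pow_left₀ (by norm_num) hT 2
      nlinarith only [h4, h5, h6]
    linarith only [h1, h2]
  have hexp : Real.exp u ≤ 1.7586 := by
    have hmono : Real.exp u ≤ Real.exp 0.5645 := Real.exp_le_exp.2 hu1
    have hb : Real.exp (0.5645 : ℝ) ≤ 1.7586 := by
      have := Real.exp_bound' (x := (0.5645 : ℝ)) (by norm_num) (by norm_num) (n := 6) (by norm_num)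
      simp only [Finset.sum_range_succ, Finset.sum_range_zero, Nat.factorial] at this
      norm_num at this
      linarith
    exact hmono.trans hb
  linarith only [hexp]

/-- **Part (2) of the third-slab discharge: the profile-control constants at the schedule `y = 38`, `N₁ = 46`.**
`N₁+1 ≤ pL/(2W)`, `ρ₁ < 1`, `ρ₂ ≤ e^{-2}`, `11/50 ≤ κ`, for the sizes of part (1). [this track, ATTEMPT-23 §7] -/
theorem profile_constants_slabThree {b T k pL W y lamU ρ1 ρ2U ηU τ1 τ2U κ : ℝ} {N₁ : ℕ}
    (hb1 : b ≤ 507 / 100) (hT : 213000 ≤ T) (hW1 : T ^ 2 ≤ W) (hW3 : W ≤ T ^ 2 + 1 / 4) (hk0 : 2 ≤ k)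
    (hk : k ≤ 0.3184 * b * T) (hpL : T ^ 3 / 28.36 ≤ pL)
    (hy : y = 38) (hN₁ : N₁ = 46)
    (hlamU : lamU = 1 + k * (T + 1 / 2) / pL)
    (hρ1 : ρ1 = Real.exp (3 + lamU) * (4 * y ^ 2) / (4 * ((N₁ : ℝ) + 1) ^ 3))
    (hρ2U : ρ2U = 8 * Real.exp 2 * W ^ 3 * y ^ 2 / pL ^ 3)
    (hηU : ηU = Real.exp (2 * (1 / pL + k * (T + 1 / 2) / pL ^ 2) * W * (N₁ : ℝ) ^ 2) - 1)
    (hτ1 : τ1 = ρ1 ^ (N₁ + 1) / (1 - ρ1))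
    (hτ2U : τ2U = Real.exp (pL / W * (1 + 1 / 2 * Real.log ρ2U) + k * (T + 1 / 2) / (2 * W)) / (1 - ρ2U))
    (hκ : κ = 1 - ηU - 3 * τ1 - τ2U) :
    (N₁ : ℝ) + 1 ≤ pL / (2 * W) ∧ ρ1 < 1 ∧ ρ2U ≤ Real.exp (-2) ∧ 11 / 50 ≤ κ := by
  have hT0 : 0 < T := by linarith
  have hW0 : 0 < W := lt_of_lt_of_le (by positivity) hW1
  have hk00 : 0 ≤ k := by linarith only [hk0]
  have hk' : k ≤ 1.615 * T := by nlinarith only [hk, hb1, hT0]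
  have hpL0 : 0 < pL := lt_of_lt_of_le (by positivity) hpL
  have hν := nu_le_slabThree hT hk' hpL
  have hν0 : 0 ≤ k * (T + 1 / 2) / pL := by positivity
  have hN : (N₁ : ℝ) + 1 ≤ pL / (2 * W) := by
    rw [hN₁]; push_cast
    have := N_le_slabThree hT hW0 hW3 hpL
    linarith only [this]
  have hρ1le := rho1_le_slabThree (ν := k * (T + 1 / 2) / pL) hν0 hν hlamU rfl hy hN₁ hρ1
  have hρ1ge : 0 ≤ ρ1 := by rw [hρ1]; positivity
  have hτ1le := tau1_le_slabThree hρ1ge hρ1le hN₁ hτ1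
  have hρ2le := rho2_le_slabThree hT hW0 hW3 hpL hy hρ2U
  have hρ2ge : 0 < ρ2U := by rw [hρ2U, hy]; positivity
  have hρ2e : ρ2U ≤ Real.exp (-2) := by
    refine hρ2le.trans ?_
    rw [Real.exp_neg, le_inv_comm₀ (by norm_num) (Real.exp_pos _)]
    have := exp_numerics.1; norm_num; linarith only [this]
  have hτ2le := tau2_le_slabThree hT hk' hW1 hW3 hpL hρ2ge hρ2le hτ2U
  have hηle := eta_le_slabThree hT hk00 hW0 hW3 hpL hν hN₁ hηU
  refine ⟨hN, by linarith only [hρ1le], hρ2e, ?_⟩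
  rw [hκ]; linarith only [hηle, hτ1le, hτ2le]

end Summit.RiemannHypothesis.RiemannHypothesis.Theorems.Handoff

end
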